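import Mathlib
import HarnessLib
import HarnessLib.Audit
import Summits.AtomisticToContinuum.Statement
import Literature.MathematicalPhysics.QuantumLattice.HeisenbergModel
import Literature.Barriers.AtomisticToContinuum.FeynmanCyclesVersusCondensation
import Summits.AtomisticToContinuum.BoseEinsteinCondensation.Theorems.BECInfraredBoundAssembly
import Summits.AtomisticToContinuum.BoseEinsteinCondensation.Theorems.BECCutLineWeakDisorderOccupationStability
import HarnessLib.Audit.Status.Attr

/-!
Route: BECThermalBridge

DORMANT since 2026-08-25T09:11:23Z (reconciler: no traction for 7.6 d (last activity item-evidence-added at 2026-08-17T19:09:23Z); parked, not closed — `ledger route dormant route-AtomisticToContinuum-BECThermalBridge --off` to reactiva) — unstaffed, not closed; items shared with open routes are served there. `ledger route dormant <id> --off` reactivates.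

# Route BECThermalBridge — heating only depletes — β-monotone condensate occupation turns BEC at any
one positive temperature into ground-state BEC

X = ThermalMonotonicity ∧ ThermalBEC (card heating-only-depletes-thermal-bridge, items M1 and M3;
D-0027 §2.1-conforming re-opening of
the retired route-AtomisticToContinuum-BECThermalMonotonicity, whose only defect was an Assembly
concluding the Literature decl instead of the
audited abbrev `_root_.BoseEinsteinCondensation`). "It suffices to show": (M_T) HEATING ONLY
DEPLETES — for every repulsive finite-range v,
at small density and all large N, the canonical thermal occupation of the constant mode φ₀ =
L^(-3/2)·1_box of N bosons in the Dirichlet box of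
side L = (N/ρ)^(1/3) never decreases on cooling (d⟨n(φ₀)⟩/dβ = −Cov_β(H, n(φ₀)) ≥ 0: the bosonic
U(1) Griffiths-II/Ginibre inequality in the
one variable nobody has tried, β), thermal states being typed operator-free as δ-near-minimising
finite ensembles of the free energy exactly
as in route BECClassicalWindow (ThermalMonotonicity is SHARED VERBATIM with it,
stmt-AtomisticToContinuum-9071); and (ThermalBEC, the
CONDITIONAL input in its weakest form) thermal constant-mode occupation ≥ cN at SOME temperature
T(v,ρ) > 0, uniformly in N. Then cooling to
T → 0 at fixed (N, L) hands ≥ cN/16 to every near-minimiser of the Dirichlet energy (supports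
ThermalGroundStateLimit, OccupationStability,
GroundStateRigidity, glue BridgeDescent), i.e. X_B1 (stmt-0686), and X_B1 → BoseEinsteinCondensation
is PROVED (bec_of_zeroMode).
CONDITIONAL IN SUBSTANCE: ThermalBEC is positive-temperature BEC of an interacting continuum gas
(open); per rule 4b it is filed as a crux
item rather than `conditional_on`, because it is no catalogued named conjecture and because the
route's OWN content — rank 2, the lattice
probe rank 4, the ideal-gas support and the descent — is what is staffed; ANY future T > 0 proof
(classical window T = θρ^(2/3) of
BECClassicalWindow, a Bogoliubov-regime proof at T ~ ρa, loop/cycle programmes) discharges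
ThermalBEC, since ∃T is strictly weaker than each.
Lean: `ThermalMonotonicity ∧ ThermalBEC`

## Assembly
DECIDING THEOREM (glue.lean; sorry-free, axioms propext / Classical.choice / Quot.sound, rc 0 on the
farm inside Sketch.lean):
`theorem closes : ThermalBEC → ThermalMonotonicity → GroundStateRigidity → ThermalGroundStateLimit →
OccupationStability → BridgeDescent →
_root_.BoseEinsteinCondensation := fun h₁ h₂ h₃ h₄ h₅ h₆ =>
AtomisticToContinuum.BECInfraredBound.bec_of_zeroMode (h₆ h₁ h₂ h₃ h₄ h₅)` —
BridgeDescent lands on X_B1 (stmt-AtomisticToContinuum-0686) and X_B1 → BoseEinsteinCondensation is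
the PROVED theorem
`AtomisticToContinuum.BECInfraredBound.bec_of_zeroMode` (Theorems/BECInfraredBoundAssembly.lean:
occupation_le_maxOccupation +
le_condensateNumber). The probes XYThermalMonotonicity and IdealGasThermalMonotonicity are instances
of the rank-2 mechanism and do not enter.

Rationale: WHY THIS LINE. Every one-parameter regularisation used on the conjunct improves condensation AWAY
from the physical point — gauge-breaking source λ
(Literature.Barriers.AtomisticToContinuum.SymmetryBreakingWithoutCondensate), pinning/one-body gap
(route BECPinning), negative curvature
(Lemm–Siebert arXiv:2202.01538), finite box (KineticGapLengthScales) — so convexity/monotonicity has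
only ever transported UPPER bounds; temperature
is the one deformation whose favourable end IS the conjunct (T = 0), and d⟨n(φ₀)⟩/dβ is an ORDINARY
covariance (H commutes with e^(−βH)), the
U(1)/boson analogue of Griffiths II (Ginibre1970 plane rotators, Gallavotti1971) whose quantum S = ½
XY version BenassiLeesUeltschi2016
(arXiv:1510.03215 Thm 1, Cor 2 — PROVED in tree, XYGriffithsBLUProofs/GinibreDoubling) signs ∂_(J¹)
≥ 0 and ∂_(J²) ≤ 0 separately and leaves
exactly the β-derivative (J¹ and J² scaled together) open. Imported areas: correlation-inequality
technology of classical/quantum lattice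
statistical mechanics (Ginibre duplication and positive cones; FKG/association for the stoquastic
Feynman–Kac loop measure), quantum
information (Gibbs variational principle + Pinsker to type thermal states without operators), and —
through the conditional slot — the whole
positive-temperature literature (SeiringerUeltschi2009, DeuchertSeiringer2020, HaberbergerEtAl2023,
FournaisEtAl2024). What no other route
does: BECClassicalWindow bets on one specific T > 0 ENGINE (classical φ⁴₃ window at T = θρ^(2/3))
and carries M_T only as its descent; this route
bets on the BRIDGE itself, with the weakest conditional (∃T) and the card's two typable instances
where truth is known — the S = ½ XY torus
(BEC a theorem at T = 0, KLS1988PRL, and at low T, DysonLiebSimon1978) and the ideal gas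
(Ueltschi2006, canonicalZ in tree) — so that M_T can be
proved or refuted NOW on objects Lean already has; the only T → 0 descent in print
(KennedyLiebShastry1988) is welded to Gaussian domination.
Negatives index (6 refuted statements in the summit, 1 in this conjunct: BECSwapAffinity's
SwapJensen) contains nothing thermal.

RANKED CRUXES. #2 ThermalMonotonicity (crux) — (card M1 = M_T, dilute eventual form, Dirichlet box,
constant mode; SHARED VERBATIM with route BECClassicalWindow, stmt-AtomisticToContinuum-9071) for
every repulsive finite-range v there is ρ₀ > 0 such that for 0 < ρ < ρ₀ and all large N (L =
(N/ρ)^(1/3)), for all temperatures 0 < T₂ ≤ T₁ and every c: if for some δ > 0 every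
δ-near-minimising finite ensemble (pᵢ, Ψᵢ) (pairwise L²-orthogonal Dirichlet trial states,
probability weights) of the free energy Σpᵢ·energy(Ψᵢ) − T₁·Σ negMulLog pᵢ has thermal constant-mode
occupation Σpᵢ⟨φ₀,γ_(Ψᵢ)φ₀⟩ ≥ c, then for every c′ < c there is δ′ > 0 such that every
δ′-near-minimising ensemble at T₂ has occupation ≥ c′ — T ↦ Tr Γ_T n(φ₀) is non-increasing ("heating
only depletes"; d⟨n(φ₀)⟩/dβ = −Cov_β(H, n(φ₀)) ≥ 0). Bogoliubov-exact term by term (each thermal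
quasiparticle removes ≥ 1 particle from the condensate); β = 0 and β = ∞ ends consistent (novelty
audit 32: bunching factor 2; level ordering); the open middle is the content. [difficulty: L] (why
it might fail: No Ginibre cone/FKG structure signs Cov_β(H,n(φ₀)) for interacting bosons (BLU: U(1)
combination indefinite; quantum Griffiths II fails, HurstSherman1969); exact monotonicity at ALL
T>0, N fixed, dies on one low level more φ₀-condensed than Ψ₀ or on Dirichlet mixing of the
non-eigen constant mode.) [Ginibre1970, BenassiLeesUeltschi2016, arXiv:1510.03215, Gallavotti1971,
HurstSherman1969, KennedyLiebShastry1988, FrohlichPark1980, LSSY2005, Ueltschi2006]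
#3 ThermalBEC (crux) — (card M3, the CONDITIONAL input, weakest form ∃T) positive-temperature BEC at
ONE temperature, uniformly in the particle number: for every repulsive finite-range v there is ρ₀ >
0 such that for 0 < ρ < ρ₀ there are T > 0 and c > 0 with: for all large N there is δ > 0 such that
every δ-near-minimising finite ensemble of the free energy Σpᵢ·energy(Ψᵢ) − T·Σ negMulLog pᵢ in the
Dirichlet box of side (N/ρ)^(1/3) has thermal constant-mode occupation Σpᵢ⟨φ₀,γ_(Ψᵢ)φ₀⟩ ≥ cN.
Strictly weaker than BECClassicalWindow's ThermalWindowZeroMode (T = θρ^(2/3); the implication is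
checked sorry-free in Sketch.lean), so any T > 0 proof at any temperature discharges it; true for v
≡ 0 (canonical ideal gas below T_c⁰ = 4π(ρ/ζ(3/2))^(2/3), constant-mode share (8/π²)³ = 0.533 of the
ground mode). Deliberately not decomposed here. [difficulty: open-problem] (why it might fail: It is
T>0 BEC in the thermodynamic limit for an interacting continuum gas — open at every T < T_c
(rigorous: only T_c upper bounds, SeiringerUeltschi2009; BEC only in GP scalings,
DeuchertSeiringer2020); needs d = 3 explicitly (Hohenberg); hard cores need the v ↦ 8πa ladder
first.) [LSSY2005, SeiringerUeltschi2009, DeuchertSeiringer2020, Seiringer2008, HaberbergerEtAl2023,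
FournaisEtAl2024, Ueltschi2006, Suto2002]
#4 XYThermalMonotonicity (crux) — (card M1's first typable instance — the PROBE where BEC is a
theorem at both ends: KLS1988PRL ground state d ≥ 2, DysonLiebSimon1978 Thm 4.2 =
kennedy_lieb_shastry_xy_thermal low T d ≥ 3) for the S = ½ ferromagnetic quantum XY model xyTorus d
L 1 (= hard-core lattice bosons at zero field) on the torus (ℤ/Lℤ)^d, d ≥ 2, every side L ≥ 1: β ↦
Σ_(x,y) Re⟨S¹_xS¹_y + S²_xS²_y⟩_(β,L) = ⟨(S¹_tot)² + (S²_tot)²⟩_β (xyCorrTorus summed over all pairs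
= the full-trace one-particle density matrix summed over x, y) is non-decreasing on [0, ∞). Exactly
the combination BenassiLeesUeltschi2016 Cor. 2 leaves unsigned (∂_(J¹)⟨S¹S¹⟩ ≥ 0, ∂_(J²)⟨S¹S¹⟩ ≤ 0,
both PROVED in tree with Ginibre's doubled system), so a proof here is the template for rank 2 and a
refutation for large L in d = 3 kills the mechanism. Exactly solvable interacting anchors with
explicit monotone n₀(β): hard-core bosons on the complete graph (Toth1990, Penrose1991).
[difficulty: M] (why it might fail: d/dβ = Σ_b(∂_(J¹_b)+∂_(J²_b)) is a difference of BLU-positive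
terms; the ALL-L claim needs O(Ψ₀) ≥ O(Ψ₁) on every small torus (m = ±1 tower states vs the m = 0
ground state; rings violate ferromagnetic level ordering, SpitzerStarrTran2012) — one 3×3 or 2×2×2
ED curve refutes it as typed.) [BenassiLeesUeltschi2016, arXiv:1510.03215, Ginibre1970,
Gallavotti1971, HurstSherman1969, KLS1988PRL, DysonLiebSimon1978, NachtergaeleSpitzerStarr2004,
SpitzerStarrTran2012, Toth1990, Penrose1991]
#5 GroundStateRigidity (crux) — (SHARED VERBATIM with BECClassicalWindow
stmt-AtomisticToContinuum-9072 / BECPalmLandscape; the uniqueness input of the descent) for every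
repulsive finite-range v there is ρ₀ > 0 such that for 0 < ρ < ρ₀ and all large N, for every η > 0
there is δ > 0 with: any two δ-near-minimisers Ψ, Φ of the Dirichlet energy in the box of side
(N/ρ)^(1/3) satisfy ∫|Ψ − cΦ|² ≤ η for some unit complex c (E₀ < ∞, compact resolvent, unique
positive ground state and spectral gap at fixed N). [difficulty: M] (why it might fail: Admissible v
may be ⊤-valued (hard cores, hollow shells): the finite-energy configuration set can disconnect and
a non-dilute component (jammed or bound cluster) may minimise, degenerating the Dirichlet ground
space; positivity-improving uniqueness needs finite v.) [ReedSimonIV1978, Simon1982,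
BaryshnikovBubenikKahle2013, Kahle2012, LSSY2005]
#9 ThermalGroundStateLimit (support) — (card M4, the β → ∞ step at fixed N and L > 0; SHARED
VERBATIM with BECClassicalWindow stmt-AtomisticToContinuum-9073) if for some c and all temperatures
0 < T ≤ T₀ there is δ(T) > 0 such that every δ-near-minimising ensemble of the free energy at T has
thermal constant-mode occupation ≥ c, then for every c′ < c and every energy slack δ′ > 0 some
Dirichlet trial state Ψ has energy ≤ E₀(N,L) + δ′ and ⟨φ₀,γ_Ψφ₀⟩ ≥ c′. Content: Z(β) = Tr_sym
e^(−βH) < ∞ (compact resolvent, Weyl), the finite-ensemble infimum of F is −T log Z (Gibbs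
variational principle on the C¹ form core), Pinsker F(Γ) − F(Γ_T) = T·S(Γ‖Γ_T) ≥ (T/2)‖Γ − Γ_T‖₁²,
Γ_T → Π₀/g in trace norm as T → 0, form-core approximation of a ground state, L²-continuity of the
occupation. [difficulty: L] [ReedSimonIV1978, BratteliRobinsonII1997, LSSY2005]
#9 OccupationStability (support) — (SHARED VERBATIM with BECClassicalWindow
stmt-AtomisticToContinuum-9074 / BECPalmLandscape) for a normalised measurable mode u, trial states
Ψ, Φ ∈ TrialState (n+1) L and |c| = 1: occ(u,Ψ)^(1/2) ≤ occ(u,Φ)^(1/2) + (n+1)^(1/2)·‖Ψ − cΦ‖₂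
(Minkowski in L²(dY); occ(cΦ) = occ(Φ)). [difficulty: provable-now] [LSSY2005]
#9 IdealGasThermalMonotonicity (support) — (card M2, the ideal-gas warm-up in the tree's
Feynman-cycle vocabulary; torus, zero mode) for v = 0 the canonical zero-mode occupation
⟨n₀⟩_(Λ,N)(β) = Σ_(i=1..N) Z_(N−i)(β)/Z_N(β) (zeroModeOccupation, canonicalZ of
Literature.Barriers.AtomisticToContinuum.BoseGas.IdealGas) is non-decreasing in β > 0 for every N
and every side L ≠ 0: d/dβ log(Z_(N−i)/Z_N) = ⟨H⟩_N − ⟨H⟩_(N−i) ≥ 0 because the canonical occupation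
numbers ⟨n_k⟩_N of the free Bose gas increase with N (Borrmann–Franke recursion Z_N = N⁻¹Σ_j
z(jβ)Z_(N−j); log-concavity-type inequalities for canonicalZ). Exact numerics: monotone for N =
10…300 (pure-Python run in this planner's folder); N ≤ 2000 queued as kit job j003651. [difficulty:
M] [Ueltschi2006, Suto2002, PuleZagrebnov2004]
#9 BridgeDescent (support) — (glue, provable now: the analytic bookkeeping of the assembly isolated
as one lemma so that the deciding theorem is one line; twin of BECClassicalWindow's ThermalDescent
stmt-AtomisticToContinuum-9075 with ThermalBEC in place of ThermalWindowZeroMode) ThermalBEC →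
ThermalMonotonicity → GroundStateRigidity → [ThermalGroundStateLimit, inlined] →
[OccupationStability, inlined] → X_B1 (stmt-AtomisticToContinuum-0686 body verbatim: for every
admissible v there is ρ₀ with, for ρ < ρ₀, c > 0 and eventually in N a slack δ > 0 such that every
δ-near-minimiser Ψ of the Dirichlet energy has ⟨φ₀,γ_Ψφ₀⟩ ≥ cN). Proof: fix v; take ρ below the
three thresholds; ThermalBEC gives T₁, c and, eventually in N, thermal occupation ≥ cN at T₁;
ThermalMonotonicity transports ≥ cN/2 to every T₂ ≤ T₁, which is the hypothesis of
ThermalGroundStateLimit (T₀ = T₁): for every energy slack δ′ some δ′-near-minimiser has occupation ≥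
cN/4; GroundStateRigidity with η = c/16 and OccupationStability give occ(Φ)^(1/2) ≥ (cN/4)^(1/2) −
(N·c/16)^(1/2) = (cN)^(1/2)/4 for EVERY δ_R-near-minimiser Φ, i.e. X_B1 with constant c/16
(intersect the eventual-in-N sets; ENNReal.ofReal / rpow ½ arithmetic). [difficulty: provable-now]
[LSSY2005]

TWO-LAYER PLAN. Foreseen, nothing filed now (k ≤ 3 children each, depth 1). ThermalMonotonicity ⇐
KineticCovarianceNonpositive → InteractionCovarianceNonpositive →
ThermalMonotonicity (Cov_β(T_kin, n(φ₀)) ≤ 0 and Cov_β(V, n(φ₀)) ≤ 0 separately, only if one common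
cone signs both), OR ThermalMonotonicity ⇐
LatticeRegularisedMonotonicity (Bose–Hubbard on (εℤ ∩ box)³ with the sampled v, every ε) →
ContinuumLimitOfThermalOccupation (ε → 0 at fixed N,
L, T) → ThermalMonotonicity, OR the eventual form GroundStateMostCondensed (⟨n(φ₀)⟩_T ≤ n(φ₀)(Ψ₀) +
o(N), all the assembly uses) as the
single repaired child if exact monotonicity dies. XYThermalMonotonicity ⇐ TowerLevelOrdering (O(Ψ₀)
≥ O on the m = ±1 multiplet, small L) →
GinibreConeForBeta (duplicated-system positivity of Σ_b(S¹S¹ + S²S²)_b,± against O) →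
XYThermalMonotonicity. ThermalGroundStateLimit ⇐
PartitionFinite → GibbsToGroundSpace → TrialApproximation. ThermalBEC is another route's theorem
(BECClassicalWindow's ThermalWindowZeroMode
implies it) or any future T > 0 proof — never decomposed here.

KILL CRITERIA. (i) ¬ThermalMonotonicity for some admissible v at all small ρ along infinitely many N
— e.g. the exact canonical ideal gas (v ≡ 0 is admissible;
kit job j003651 computes F_N(β) = Σ_k w_k⟨n_k⟩ for N ≤ 2000) or an ED re-entrance that GROWS with N
— refutes the shared crux for this route AND
BECClassicalWindow: repair once by the eventual form GroundStateMostCondensed (new item, glue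
re-certified); if that dies too, `close --reason
refuted:ThermalMonotonicity`. (ii) ¬XYThermalMonotonicity on a small torus only (2×2, 3×3, 2×2×2) is
class misstated: repaired item with L ≥ L₀
or even L; a violation persisting for large L in d = 3 kills the mechanism and closes the route.
(iii) ¬GroundStateRigidity (degenerate
Dirichlet ground states for ⊤-valued v at low density) breaks the Dirichlet descent of every
X_B1-type route: pivot to the torus chain
(PeriodicBEC stmt-0826 + BoundaryTransferWeak stmt-0827) with the torus zero mode. (iv) ThermalBEC
is conditional: its refutation in d = 3 would
overturn physics and closes everything thermal; X_B1 (stmt-0686) or the conjunct proved elsewhere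
moots the route; ThermalWindowZeroMode proved
in BECClassicalWindow plus rank 2 here closes the conjunct through either route.

NOT DECOMPOSED YET. The proof strategy of rank 2 (Ginibre duplication with the U(1)-symmetric cone
S⁺⊗S⁻ + S⁻⊗S⁺; FKG/association between winding and energy
estimators of the Feynman–Kac loop measure; lattice regularisation + continuum limit) — layer-2
children only after the ED scan (j003692) and
the XY probe report. The analysis inside ThermalGroundStateLimit (Z < ∞, Gibbs → ground space,
form-core approximation). ThermalBEC entirely
(other routes / future T > 0 proofs). The torus variant of all statements (lands on PeriodicBEC,
stmt-0826), the mode-free λ_max form (λ_max is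
convex in γ — not obviously monotone in β; the card's own caution), canonical vs grand-canonical, d
= 1, 2 versions of the probe (no LRO there,
monotonicity may still hold but carries no weight for d = 3), S = 1 and staggered-field (λ ≠ 0,
hardCoreLatticeGas) variants of the probe.

CHEAPEST FALSIFIER. RUN by this planner (pure-Python ED, this folder's ed/purepy_ed.py,
purepy_ideal.py; f′(β) = −Cov_β(H,O) from the spectrum, β ∈ [0,60]): XY probe (rank 4, full trace, O
= (S¹_tot)²+(S²_tot)²) on chains L = 2…6, tori 2×2, 3×3, 2×2×2 — ALL monotone, level test
O(Ψ₀) > O(Ψ₁) in every case (3×3: 23.84 vs 21.94; 2×2×2: 19.00 vs 18.35); torus Bose–Hubbard ⟨n₀⟩_β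
canonical (3×3 N = 2, 3 hard-core; 2×2 and
3×3 with U = 4, N ≤ 3; 2×2×2 N = 2, 3) — all monotone; OPEN-box constant-mode occupation (the
Dirichlet analogue of rank 2: 3×3 N = 2, 3 hard-core
and U = 4; 4×4 N = 2; 2×2×2 N = 3) — all monotone; v ≡ 0 (admissible!) exact canonical ideal gas by
the Borrmann–Franke recursion: Dirichlet
constant-mode F_N(β) for N = 10, 30, 100, 300 monotone on [0.02, 40]β_c, saturating at (8/π²)³ =
0.5326; torus ⟨n₀⟩_N monotone
(IdealGasThermalMonotonicity): 19 ED cases + 8 curves: 0 violations. QUEUED kit jobs extending this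
(→ item evidence): j003692
(thermal_monotonicity_ed.py: + 4×4 XY, chains ≤ 10, N ≤ 5, U ∈ {0, 2, 4, 10}) and j003651
(ideal_gas_canonical.py: N ≤ 2000). Still cheap and
lethal: a negative f′ on larger clusters that grows with N (rank 2) or persists for large L in d = 3
(rank 4).

NUMBERS. Units ħ = 2m = k_B = 1. Free critical temperature T_c⁰ = 4π(ρ/ζ(3/2))^(2/3) = 6.625ρ^(2/3),
β_c = 0.1509ρ^(-2/3); ideal condensate fraction
1 − (T/T_c⁰)^(3/2) (canonical zero-mode version: Ueltschi2006 Thm 4, proved in tree as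
ueltschi2006_zeroModeOccupation_holds); free Dirichlet
constant-mode share of the ground mode (8/π²)³ = 0.5325; rigorous T_c UPPER bound T_c ≤ T_c⁰(1 +
5.09√(aρ^(1/3))) (SeiringerUeltschi2009); no
lower bound / no BEC at any T > 0 for any interacting continuum gas in the thermodynamic limit (GP
scalings only: DeuchertSeiringer2020).
Lattice: XY LRO for d ≥ 2 at T = 0, all S (KLS1988PRL); d ≥ 3 at large β (DysonLiebSimon1978 Thm
4.2). Large-β sign of f′: p₀p₁(E₁ −
E₀)(O(Ψ₀) − O(Ψ₁)); β = 0 end: −Cov₀(H, O) = −Tr(HO)/D > 0 for the XY probe (only same-bond terms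
survive the trace). Items at open: 9 (4 cruxes,
4 supports incl. the glue BridgeDescent, 1 assembly) + the deciding theorem; 4 of them shared with
BECClassicalWindow.

DEFINITION REQUESTS. None new. The thermal items use the operator-free ensemble vocabulary verbatim
(TrialState, energy, groundStateEnergy, occupation, box,
sideLength, IsRepulsiveFiniteRange, Real.negMulLog); the definition request `ThermalExpectation`
(canonical Gibbs expectation of a bounded
one-body observable, topic Literature/MathematicalPhysics/QuantumManyBody) already filed from
BECClassicalWindow/BECThermalWindow would let ranks
2, 3 and the two thermal supports restate in one line each; xyCorrTorus / xyTorus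
(Literature.MathematicalPhysics.QuantumLattice.XYOrder) and
zeroModeOccupation / canonicalZ (Literature.Barriers.AtomisticToContinuum.BoseGas.IdealGas) exist.
No cite facts requested (BLU Cor 2 is
vendored as benassiLeesUeltschi2016_cor2 and proved; KLS/DLS facts
kennedy_lieb_shastry_xy_ground/_thermal exist).

Novelty: Searches (2026-08-15, this seat; searchd local index rc 75, OpenAlex HTTP 429, arXiv leg 0 rows,
vsearch graph reset — recorded as run):
`lit search --source crossref "correlation inequalities quantum XY model monotonicity temperature"`
(10: doi:10.1007/s10955-016-1580-2 and
doi:10.1007/978-3-319-58904-6_2 = BLU 2016/2017, the rest physics/irrelevant); `--source crossref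
"condensate fraction decreasing function of
temperature rigorous Bose gas"` (9: doi:10.1103/physreva.54.r4633,
doi:10.1070/qe2000v030n05abeh001738 — physics estimates only); `--source
crossref "Griffiths inequalities Bose Einstein condensation temperature"` (10, none relevant); the
same three on zbMATH (0, 0, 0); `lit galaxy
search --star all "monotonic in the temperature"` (1 irrelevant web row) and `"Griffiths inequality
for the Bose gas"` (0); `ledger negatives
--problem AtomisticToContinuum` (6, none thermal); tree search:
Literature/MathematicalPhysics/QuantumLattice/XYGriffithsBLU*.lean and
GinibreDoubling*.lean (BLU Thm 1/Cor 2 proved — the β-combination absent), Theses/*.lean grep for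
thermal monotonicity (only BECClassicalWindow /
retired BECThermalWindow, BECThermalMonotonicity carry it). Plus the card's searches and five
refuter audits (triage-11, audits 14/26/36/32-g2:
Fröhlich–Park 1978/1980 scope = thermodynamic limit, acq-01716 still open; Tóth 1990 / Penrose 1991
complete-graph anchors).
Nearest prior art found: BenassiLeesUeltschi2016 (arXiv:1510.03215 Thm 1, Cor 2: monotonicity in the
COUPLI  [refs: 10.1007/s10955-016-1580-2, 10.1007/978-3-319-58904-6_2, 10.1103/physreva.54.r4633, 10.1070/qe2000v030n05abeh001738, 1510.03215, doi:10.1007/s10955-016-1580-2, doi:10.1007/978-3-319-58904-6_2, doi:10.1103/physreva.54.r4633, doi:10.1070/qe2000v030n05abeh001738, BenassiLeesUeltschi2016, Ginibre1970, Gallavotti1971, KennedyLiebShastry1988, FrohlichPark1980]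

Barriers (technique_class: correlation-inequality thermal-monotonicity bridge): - technique_class: correlation-inequality thermal-monotonicity bridge
- Literature.Barriers.AtomisticToContinuum.SymmetryBreakingWithoutCondensate: the route is built on
this barrier's lesson (source/tilt deformations transport only upper bounds to λ = 0); no
gauge-breaking source, quasi-average or c-number substitution is used — β is the deformation and its
physical end is the conjunct; the token "Griffiths" in the barrier's class means Griffiths' 1966
source-field argument, not Griffiths–Ginibre correlation inequalities.
- Literature.Barriers.AtomisticToContinuum.SymmetryBreakingWithoutCondensateNarrow: its type-III /
generalized-condensation scenario lives in anisotropic Casimir boxes at T > 0; ThermalBEC and rank 2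
are stated on cubes L = (N/ρ)^(1/3) with one fixed mode, where the free gas condenses into a single
mode (Ueltschi2006_zeroModeOccupation, proved; CasimirBoxGeneralizedCondensation type I).
- Literature.Barriers.AtomisticToContinuum.KineticGapLengthScales: evaded — no energy window of
thermodynamic size is converted into depletion; the fixed-N gap enters only ThermalGroundStateLimit
/ GroundStateRigidity with δ, T → 0 AFTER N is fixed.
- Literature.Barriers.AtomisticToContinuum.KineticGapLengthScalesNarrow: the Galilei-boost lemma
binds ENERGY-WINDOW arguments (input = ⟨Ψ,HΨ⟩ ≤ E₀ + δ only); here the input on the state is a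
THERMAL expectation at fixed T > 0 plus a covariance sign, and X_B1's δ is chosen after N (below the
fixed-N gap) — the exit the audit name

History (route lifecycle, newest last):
- 2026-08-15T19:25:39Z · rev 1: restated XYThermalMonotonicity (stmt-AtomisticToContinuum-13388) — cone repair (unit rrepair-AtomisticToContinuum-BECTherma-212e106a): restate the rank-4 probe XYThermalMonotonicity 1:1 over HeisenbergModel-level vocabulary — x (operator:999:3162435)
- 2026-08-25T09:11:23Z · DORMANT — reconciler: no traction for 7.6 d (last activity item-evidence-added at 2026-08-17T19:09:23Z); parked, not closed — `ledger route dormant route-AtomisticToConti (operator:999:3933062)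

sub-problem: BoseEinsteinCondensation · status: dormant · opened planner-plancard-AtomisticToContinuum-BoseEin-82402888-g2-0 2026-08-15T19:01:29Z · rev 2 · ledger route-AtomisticToContinuum-BECThermalBridge
GENERATED by the gate from the ledger (D-0016/17). Provers cite these decls: `theorem foo : Summit.AtomisticToContinuum.BoseEinsteinCondensation.Theses.BECThermalBridge.<Decl> := …` in Summits/AtomisticToContinuum/BoseEinsteinCondensation/Theorems/<Name>.lean.
-/

namespace Summit.AtomisticToContinuum.BoseEinsteinCondensation.Theses.BECThermalBridge

open scoped BigOperators Topology Manifold Classical MeasureTheory ProbabilityTheory Matrix InnerProductSpace ComplexConjugate ContinuousMap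
open Filter Set Function TopologicalSpace MeasureTheory

attribute [summit_statement] _root_.BoseEinsteinCondensation

/-- item stmt-AtomisticToContinuum-9071 · crux · rank 2 · open · by planner
why it might fail: No Ginibre cone/FKG structure signs Cov_β(H,n(φ₀)) for interacting bosons (BLU: U(1) combination indefinite; quantum Griffiths II fails, HurstSherman1969); exact monotonicity at ALL T>0, N fixed, dies on one low level more φ₀-condensed than Ψ₀ or on Dirichlet mixing of the non-eigen constant mode.
sources: Ginibre1970, BenassiLeesUeltschi2016, arXiv:1510.03215, Gallavotti1971, HurstSherman1969, KennedyLiebShastry1988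
[crux] (card P4 = card heating-only-depletes-thermal-bridge's M_T, dilute eventual form, Dirichlet
box, constant mode) for every repulsive finite-range v there is ρ₀ > 0 such that for 0 < ρ < ρ₀ and
all large N (L = (N/ρ)^{1/3}), for all temperatures 0 < T₂ ≤ T₁ and every c: if for some δ > 0 every
δ-near-minimising ensemble of the free energy at T₁ has thermal constant-mode occupation ≥ c, then
for every c′ < c there is δ′ > 0 such that every δ′-near-minimising ensemble at T₂ has occupation ≥
c′ — i.e. T ↦ Tr Γ_T n(φ₀) is non-increasing ("heating only depletes"; d⟨n(φ₀)⟩/dβ = −Cov_β(H,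
n(φ₀)) ≥ 0). Bogoliubov-exact term by term (every thermal quasiparticle removes ≥ 1 particle from
the condensate); ideal gas: Borrmann–Franke recursion; interacting: unproved even on the lattice.
[difficulty: L] -/
@[route_item "route-AtomisticToContinuum-BECThermalBridge", crux]
def ThermalMonotonicity : Prop :=
  ∀ v : ℝ → ENNReal, Literature.MathematicalPhysics.QuantumManyBody.BoseGas.IsRepulsiveFiniteRange v → ∃ ρ₀ : ℝ, 0 < ρ₀ ∧ ∀ ρ : ℝ, 0 < ρ → ρ < ρ₀ → ∀ᶠ N : ℕ in Filter.atTop, ∀ (T₁ T₂ c : ℝ), 0 < T₂ → T₂ ≤ T₁ → (∃ δ : ℝ, 0 < δ ∧ ∀ (m : ℕ) (p : Fin m → ℝ) (Ψ : Fin m → Literature.MathematicalPhysics.QuantumManyBody.BoseGas.TrialState N (Literature.MathematicalPhysics.QuantumManyBody.BoseGas.sideLength ρ N)), (∀ i, 0 ≤ p i) → ∑ i, p i = 1 → (∀ i j, i ≠ j → ∫ X, (starRingEnd ℂ) ((Ψ i).ψ X) * (Ψ j).ψ X = 0) → (∀ (m' : ℕ) (p' : Fin m' → ℝ) (Ψ'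 : Fin m' → Literature.MathematicalPhysics.QuantumManyBody.BoseGas.TrialState N (Literature.MathematicalPhysics.QuantumManyBody.BoseGas.sideLength ρ N)), (∀ j, 0 ≤ p' j) → ∑ j, p' j = 1 → (∀ i j, i ≠ j → ∫ X, (starRingEnd ℂ) ((Ψ' i).ψ X) * (Ψ' j).ψ X = 0) → ∑ i, ENNReal.ofReal (p i) * Literature.MathematicalPhysics.QuantumManyBody.BoseGas.energy v (Ψ i) + ENNReal.ofReal (T₁ * ∑ j, Real.negMulLog (p' j)) ≤ ∑ j, ENNReal.ofReal (p' j) * Literature.MathematicalPhysics.QuantumManyBody.BoseGas.energy v (Ψ' j) + ENNReal.ofReal (T₁ * ∑ i, Real.negMulLog (p i) + δ)) → ENNReal.ofReal c ≤ ∑ i, ENNReal.ofReal (p i) * Literature.MathematicalPhysics.QuantumManyBody.BoseGas.occupation N ((Literature.MathematicalPhysics.QuantumManyBody.BoseGas.box (Literature.MathematicalPhysics.QuantumManyBody.BoseGas.sideLength ρ N)).indicator fun _ => ((Real.sqrt (Literature.MathematicalPhysics.QuantumManyBody.BoseGas.sideLength ρ N ^ 3))⁻¹ : ℂ)) (Ψ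 i).ψ) → ∀ c' : ℝ, c' < c → ∃ δ' : ℝ, 0 < δ' ∧ ∀ (m : ℕ) (p : Fin m → ℝ) (Ψ : Fin m → Literature.MathematicalPhysics.QuantumManyBody.BoseGas.TrialState N (Literature.MathematicalPhysics.QuantumManyBody.BoseGas.sideLength ρ N)), (∀ i, 0 ≤ p i) → ∑ i, p i = 1 → (∀ i j, i ≠ j → ∫ X, (starRingEnd ℂ) ((Ψ i).ψ X) * (Ψ j).ψ X = 0) → (∀ (m' : ℕ) (p' : Fin m' → ℝ) (Ψ' : Fin m' → Literature.MathematicalPhysics.QuantumManyBody.BoseGas.TrialState N (Literature.MathematicalPhysics.QuantumManyBody.BoseGas.sideLength ρ N)), (∀ j, 0 ≤ p' j) → ∑ j, p' j = 1 → (∀ i j, i ≠ j → ∫ X, (starRingEnd ℂ) ((Ψ' i).ψ X) * (Ψ' j).ψ X = 0) → ∑ i, ENNReal.ofReal (p i) * Literature.MathematicalPhysics.QuantumManyBody.BoseGas.energy v (Ψ i) + ENNReal.ofReal (T₂ * ∑ j, Real.negMulLog (p' j)) ≤ ∑ j, ENNReal.ofReal (p' j) * Literature.MathematicalPhysics.QuantumManyBody.BoseGas.energy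 v (Ψ' j) + ENNReal.ofReal (T₂ * ∑ i, Real.negMulLog (p i) + δ')) → ENNReal.ofReal c' ≤ ∑ i, ENNReal.ofReal (p i) * Literature.MathematicalPhysics.QuantumManyBody.BoseGas.occupation N ((Literature.MathematicalPhysics.QuantumManyBody.BoseGas.box (Literature.MathematicalPhysics.QuantumManyBody.BoseGas.sideLength ρ N)).indicator fun _ => ((Real.sqrt (Literature.MathematicalPhysics.QuantumManyBody.BoseGas.sideLength ρ N ^ 3))⁻¹ : ℂ)) (Ψ i).ψ

/-- item stmt-AtomisticToContinuum-13387 · crux · rank 3 · open · by planner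
why it might fail: It is T>0 BEC in the thermodynamic limit for an interacting continuum gas — open at every T < T_c (rigorous: only T_c upper bounds, SeiringerUeltschi2009; BEC only in GP scalings, DeuchertSeiringer2020); needs d = 3 explicitly (Hohenberg); hard cores need the v ↦ 8πa ladder first.
sources: LSSY2005, SeiringerUeltschi2009, DeuchertSeiringer2020, Seiringer2008, HaberbergerEtAl2023, FournaisEtAl2024
[crux] (card M3, the CONDITIONAL input, weakest form ∃T) positive-temperature BEC at ONE
temperature, uniformly in the particle number: for every repulsive finite-range v there is ρ₀ > 0
such that for 0 < ρ < ρ₀ there are T > 0 and c > 0 with: for all large N there is δ > 0 such that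
every δ-near-minimising finite ensemble of the free energy Σpᵢ·energy(Ψᵢ) − T·Σ negMulLog pᵢ in the
Dirichlet box of side (N/ρ)^(1/3) has thermal constant-mode occupation Σpᵢ⟨φ₀,γ_(Ψᵢ)φ₀⟩ ≥ cN.
Strictly weaker than BECClassicalWindow's ThermalWindowZeroMode (T = θρ^(2/3); the implication is
checked sorry-free in Sketch.lean), so any T > 0 proof at any temperature discharges it; true for v
≡ 0 (canonical ideal gas below T_c⁰ = 4π(ρ/ζ(3/2))^(2/3), constant-mode share (8/π²)³ = 0.533 of the
ground mode). Deliberately not decomposed here. [difficulty: open-problem] -/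
@[route_item "route-AtomisticToContinuum-BECThermalBridge", crux]
def ThermalBEC : Prop :=
  ∀ v : ℝ → ENNReal, Literature.MathematicalPhysics.QuantumManyBody.BoseGas.IsRepulsiveFiniteRange v → ∃ ρ₀ : ℝ, 0 < ρ₀ ∧ ∀ ρ : ℝ, 0 < ρ → ρ < ρ₀ → ∃ T : ℝ, 0 < T ∧ ∃ c : ℝ, 0 < c ∧ ∀ᶠ N : ℕ in Filter.atTop, ∃ δ : ℝ, 0 < δ ∧ ∀ (m : ℕ) (p : Fin m → ℝ) (Ψ : Fin m → Literature.MathematicalPhysics.QuantumManyBody.BoseGas.TrialState N (Literature.MathematicalPhysics.QuantumManyBody.BoseGas.sideLength ρ N)), (∀ i, 0 ≤ p i) → ∑ i, p i = 1 → (∀ i j, i ≠ j → ∫ X, (starRingEnd ℂ) ((Ψ i).ψ X) * (Ψ j).ψ X = 0) → (∀ (m' : ℕ) (p' : Fin m' → ℝ) (Ψ' : Fin m' → Literature.MathematicalPhysics.QuantumManyBody.BoseGas.TrialState N (Literature.MathematicalPhysics.QuantumManyBody.BoseGas.sideLength ρ N)), (∀ j, 0 ≤ p' j) → ∑ j, p'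 j = 1 → (∀ i j, i ≠ j → ∫ X, (starRingEnd ℂ) ((Ψ' i).ψ X) * (Ψ' j).ψ X = 0) → ∑ i, ENNReal.ofReal (p i) * Literature.MathematicalPhysics.QuantumManyBody.BoseGas.energy v (Ψ i) + ENNReal.ofReal (T * ∑ j, Real.negMulLog (p' j)) ≤ ∑ j, ENNReal.ofReal (p' j) * Literature.MathematicalPhysics.QuantumManyBody.BoseGas.energy v (Ψ' j) + ENNReal.ofReal (T * ∑ i, Real.negMulLog (p i) + δ)) → ENNReal.ofReal (c * N) ≤ ∑ i, ENNReal.ofReal (p i) * Literature.MathematicalPhysics.QuantumManyBody.BoseGas.occupation N ((Literature.MathematicalPhysics.QuantumManyBody.BoseGas.box (Literature.MathematicalPhysics.QuantumManyBody.BoseGas.sideLength ρ N)).indicator fun _ => ((Real.sqrt (Literature.MathematicalPhysics.QuantumManyBody.BoseGas.sideLength ρ N ^ 3))⁻¹ : ℂ)) (Ψ i).ψ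

-- earlier XYThermalMonotonicity (stmt-AtomisticToContinuum-13388, replaced 2026-08-15T19:25:39Z -> stmt-AtomisticToContinuum-13589): retired by None — ∀ (d L : ℕ) [NeZero L], 2 ≤ d → MonotoneOn (fun β : ℝ => ∑ x : Literature.Probability.LatticeModels.TorusSite d L, ∑ y : Literature.Probability.LatticeModels.TorusSite d L, Literature.MathematicalPhysics.QuantumLattice.xyCorrTorus β L 1 x y) (Set.Ici 
/-- item stmt-AtomisticToContinuum-13589 · crux · rank 4 · open · by operator
why it might fail: d/dβ = Σ_b(∂_(J¹_b)+∂_(J²_b)) is a difference of BLU-positive terms; the ALL-L claim needs O(Ψ₀) ≥ O(Ψ₁) on every small torus (m = ±1 tower states vs the m = 0 ground state; rings violate ferromagnetic level ordering, SpitzerStarrTran2012) — one 3×3 or 2×2×2 ED curve refutes it as typed.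
sources: BenassiLeesUeltschi2016, arXiv:1510.03215, Ginibre1970, Gallavotti1971, HurstSherman1969, KLS1988PRL
[crux] (card M1's first typable instance — the PROBE where BEC is a theorem at both ends: KLS1988PRL
ground state d ≥ 2, DysonLiebSimon1978 Thm 4.2 = kennedy_lieb_shastry_xy_thermal low T d ≥ 3) for
the S = ½ ferromagnetic quantum XY model H = −Σ_⟨x,y⟩(S¹_xS¹_y + S²_xS²_y) = xxzHamiltonian 1
(torusGraph d L) (−1) 0 (= hard-core lattice bosons at zero field) on the torus (ℤ/Lℤ)^d, d ≥ 2,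
every side L ≥ 1: β ↦ Σ_(x,y) Re Σ_(α=1,2) ⟨S^α_x S^α_y⟩_(β,L) = ⟨(S¹_tot)² + (S²_tot)²⟩_β
(Matrix.thermalCorr in the Gibbs state, summed over all pairs = the full-trace one-particle density
matrix summed over x, y) is non-decreasing on [0, ∞). RESTATED 2026-08-15 (cone repair) over
HeisenbergModel-level vocabulary: the filed `xyCorrTorus β L 1 x y` (XYOrder) is unfolded to `Re Σ_α
Matrix.thermalCorr β (xxzHamiltonian 1 (torusGraph d L) (-1) 0) (siteSpin 1 x α.castSucc) (siteSpin
1 y α.castSucc)` — definitionally the same statement (planner Sketch.lean `restate_faithful : new ↔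
old`, proof `dif_neg (NeZero.ne L)` then `rfl`, rc 0 on the farm), so that the route file imports
`QuantumLattice.HeisenbergModel` instead of `QuantumLattice.XYOrder → HeisenbergOrder`, whose module
cone carries the four unpr -/
@[route_item "route-AtomisticToContinuum-BECThermalBridge"]
def XYThermalMonotonicity : Prop :=
  ∀ (d L : ℕ) [NeZero L], 2 ≤ d → MonotoneOn (fun β : ℝ => ∑ x : Literature.Probability.LatticeModels.TorusSite d L, ∑ y : Literature.Probability.LatticeModels.TorusSite d L, (∑ α : Fin 2, Matrix.thermalCorr β (Literature.MathematicalPhysics.QuantumLattice.xxzHamiltonian 1 (Literature.Probability.LatticeModels.torusGraph d L) (-1) 0) (Literature.MathematicalPhysics.QuantumLattice.siteSpin 1 x (Fin.castSucc α)) (Literature.MathematicalPhysics.QuantumLattice.siteSpin 1 y (Fin.castSucc α))).re) (Set.Ici 0)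

/-- item stmt-AtomisticToContinuum-9072 · crux · rank 5 · open · by planner
why it might fail: Admissible v may be ⊤-valued (hard cores, hollow shells): the finite-energy configuration set can disconnect and a non-dilute component (jammed or bound cluster) may minimise, degenerating the Dirichlet ground space; positivity-improving uniqueness needs finite v.
sources: ReedSimonIV1978, Simon1982, BaryshnikovBubenikKahle2013, Kahle2012, LSSY2005
[crux] (shared verbatim with BECPalmLandscape stmt-AtomisticToContinuum-3298; the uniqueness input
of the descent) for every repulsive finite-range v there is ρ₀ > 0 such that for 0 < ρ < ρ₀ and all
large N, for every η > 0 there is δ > 0 with: any two δ-near-minimisers Ψ, Φ of the Dirichlet energy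
in the box of side (N/ρ)^{1/3} satisfy ∫|Ψ − cΦ|² ≤ η for some unit complex c (E₀ < ∞, compact
resolvent, unique positive ground state and spectral gap at fixed N). [difficulty: M] -/
@[route_item "route-AtomisticToContinuum-BECThermalBridge", crux]
def GroundStateRigidity : Prop :=
  ∀ v : ℝ → ENNReal, Literature.MathematicalPhysics.QuantumManyBody.BoseGas.IsRepulsiveFiniteRange v → ∃ ρ₀ : ℝ, 0 < ρ₀ ∧ ∀ ρ : ℝ, 0 < ρ → ρ < ρ₀ → ∀ᶠ N : ℕ in Filter.atTop, ∀ η : ℝ, 0 < η → ∃ δ : ENNReal, 0 < δ ∧ ∀ Ψ Φ : Literature.MathematicalPhysics.QuantumManyBody.BoseGas.TrialState N (Literature.MathematicalPhysics.QuantumManyBody.BoseGas.sideLength ρ N), Literature.MathematicalPhysics.QuantumManyBody.BoseGas.energy v Ψ ≤ Literature.MathematicalPhysics.QuantumManyBody.BoseGas.groundStateEnergy v N (Literature.MathematicalPhysics.QuantumManyBody.BoseGas.sideLength ρ N) + δ → Literature.MathematicalPhysics.QuantumManyBody.BoseGas.energy v Φ ≤ Literature.MathematicalPhysics.QuantumManyBody.BoseGas.groundStateEnergy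 v N (Literature.MathematicalPhysics.QuantumManyBody.BoseGas.sideLength ρ N) + δ → ∃ c : ℂ, ‖c‖ = 1 ∧ ∫⁻ X, (‖Ψ.ψ X - c * Φ.ψ X‖₊ : ENNReal) ^ 2 ≤ ENNReal.ofReal η

/-- item stmt-AtomisticToContinuum-13389 · support · rank 9 · open · by planner
sources: Ueltschi2006, Suto2002, PuleZagrebnov2004
[support] (card M2, the ideal-gas warm-up in the tree's Feynman-cycle vocabulary; torus, zero mode)
for v = 0 the canonical zero-mode occupation ⟨n₀⟩_(Λ,N)(β) = Σ_(i=1..N) Z_(N−i)(β)/Z_N(β)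
(zeroModeOccupation, canonicalZ of Literature.Barriers.AtomisticToContinuum.BoseGas.IdealGas) is
non-decreasing in β > 0 for every N and every side L ≠ 0: d/dβ log(Z_(N−i)/Z_N) = ⟨H⟩_N − ⟨H⟩_(N−i)
≥ 0 because the canonical occupation numbers ⟨n_k⟩_N of the free Bose gas increase with N
(Borrmann–Franke recursion Z_N = N⁻¹Σ_j z(jβ)Z_(N−j); log-concavity-type inequalities for
canonicalZ). Exact numerics: monotone for N = 10…300 (pure-Python run in this planner's folder); N ≤
2000 queued as kit job j003651. [difficulty: M] -/
@[route_item "route-AtomisticToContinuum-BECThermalBridge"]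
def IdealGasThermalMonotonicity : Prop :=
  ∀ L : ℝ, L ≠ 0 → ∀ N : ℕ, MonotoneOn (fun β : ℝ => Literature.Barriers.AtomisticToContinuum.BoseGas.IdealGas.zeroModeOccupation β L N) (Set.Ioi 0)

/-- item stmt-AtomisticToContinuum-13390 · support · rank 9 · open · by planner
sources: LSSY2005
[support] (glue, provable now: the analytic bookkeeping of the assembly isolated as one lemma so
that the deciding theorem is one line; twin of BECClassicalWindow's ThermalDescent
stmt-AtomisticToContinuum-9075 with ThermalBEC in place of ThermalWindowZeroMode) ThermalBEC →
ThermalMonotonicity → GroundStateRigidity → [ThermalGroundStateLimit, inlined] →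
[OccupationStability, inlined] → X_B1 (stmt-AtomisticToContinuum-0686 body verbatim: for every
admissible v there is ρ₀ with, for ρ < ρ₀, c > 0 and eventually in N a slack δ > 0 such that every
δ-near-minimiser Ψ of the Dirichlet energy has ⟨φ₀,γ_Ψφ₀⟩ ≥ cN). Proof: fix v; take ρ below the
three thresholds; ThermalBEC gives T₁, c and, eventually in N, thermal occupation ≥ cN at T₁;
ThermalMonotonicity transports ≥ cN/2 to every T₂ ≤ T₁, which is the hypothesis of
ThermalGroundStateLimit (T₀ = T₁): for every energy slack δ′ some δ′-near-minimiser has occupation ≥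
cN/4; GroundStateRigidity with η = c/16 and OccupationStability give occ(Φ)^(1/2) ≥ (cN/4)^(1/2) −
(N·c/16)^(1/2) = (cN)^(1/2)/4 for EVERY δ_R-near-minimiser Φ, i.e. X_B1 with constant c/16
(intersect the eventual-in-N sets; ENNReal.ofReal / rpow ½ arithmetic). [difficulty: p -/
@[route_item "route-AtomisticToContinuum-BECThermalBridge", crux]
def BridgeDescent : Prop :=
  ThermalBEC → ThermalMonotonicity → GroundStateRigidity → (∀ v : ℝ → ENNReal, Literature.MathematicalPhysics.QuantumManyBody.BoseGas.IsRepulsiveFiniteRange v → ∀ (N : ℕ) (L T₀ c : ℝ), 0 < L → 0 < T₀ → (∀ T : ℝ, 0 < T → T ≤ T₀ → ∃ δ : ℝ, 0 < δ ∧ ∀ (m : ℕ) (p : Fin m → ℝ) (Ψ : Fin m → Literature.MathematicalPhysics.QuantumManyBody.BoseGas.TrialState N L), (∀ i, 0 ≤ p i) → ∑ i, p i = 1 → (∀ i j, i ≠ j → ∫ X, (starRingEnd ℂ) ((Ψ i).ψ X) * (Ψ j).ψ X = 0) → (∀ (m' : ℕ) (p' : Fin m' → ℝ) (Ψ' : Fin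 m' → Literature.MathematicalPhysics.QuantumManyBody.BoseGas.TrialState N L), (∀ j, 0 ≤ p' j) → ∑ j, p' j = 1 → (∀ i j, i ≠ j → ∫ X, (starRingEnd ℂ) ((Ψ' i).ψ X) * (Ψ' j).ψ X = 0) → ∑ i, ENNReal.ofReal (p i) * Literature.MathematicalPhysics.QuantumManyBody.BoseGas.energy v (Ψ i) + ENNReal.ofReal (T * ∑ j, Real.negMulLog (p' j)) ≤ ∑ j, ENNReal.ofReal (p' j) * Literature.MathematicalPhysics.QuantumManyBody.BoseGas.energy v (Ψ' j) + ENNReal.ofReal (T * ∑ i, Real.negMulLog (p i) + δ)) → ENNReal.ofReal c ≤ ∑ i, ENNReal.ofReal (p i) * Literature.MathematicalPhysics.QuantumManyBody.BoseGas.occupation N ((Literature.MathematicalPhysics.QuantumManyBody.BoseGas.box L).indicator fun _ => ((Real.sqrt (L ^ 3))⁻¹ : ℂ)) (Ψ i).ψ) → ∀ c' : ℝ, c' < c → ∀ δ' : ENNReal, 0 < δ' → ∃ Ψ : Literature.MathematicalPhysics.QuantumManyBody.BoseGas.TrialState N L, Literature.MathematicalPhysics.QuantumManyBody.BoseGas.energy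 v Ψ ≤ Literature.MathematicalPhysics.QuantumManyBody.BoseGas.groundStateEnergy v N L + δ' ∧ ENNReal.ofReal c' ≤ Literature.MathematicalPhysics.QuantumManyBody.BoseGas.occupation N ((Literature.MathematicalPhysics.QuantumManyBody.BoseGas.box L).indicator fun _ => ((Real.sqrt (L ^ 3))⁻¹ : ℂ)) Ψ.ψ) → (∀ (n : ℕ) (L : ℝ) (u : Literature.MathematicalPhysics.QuantumManyBody.BoseGas.Space → ℂ), MeasureTheory.AEStronglyMeasurable u MeasureTheory.volume → ∫⁻ x, (‖u x‖₊ : ENNReal) ^ 2 = 1 → ∀ (Ψ Φ : Literature.MathematicalPhysics.QuantumManyBody.BoseGas.TrialState (n + 1) L) (c : ℂ), ‖c‖ = 1 → Literature.MathematicalPhysics.QuantumManyBody.BoseGas.occupation (n + 1) u Ψ.ψ ^ (1 / 2 : ℝ) ≤ Literature.MathematicalPhysics.QuantumManyBody.BoseGas.occupation (n + 1) u Φ.ψ ^ (1 / 2 : ℝ) + ((n + 1 : ℕ) : ENNReal) ^ (1 / 2 : ℝ) * (∫⁻ X, (‖Ψ.ψ X - c * Φ.ψ X‖₊ : ENNReal)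 ^ 2) ^ (1 / 2 : ℝ)) → ∀ v : ℝ → ENNReal, Literature.MathematicalPhysics.QuantumManyBody.BoseGas.IsRepulsiveFiniteRange v → ∃ ρ₀ : ℝ, 0 < ρ₀ ∧ ∀ ρ : ℝ, 0 < ρ → ρ < ρ₀ → ∃ c : ℝ, 0 < c ∧ ∀ᶠ N : ℕ in Filter.atTop, ∃ δ : ENNReal, 0 < δ ∧ ∀ Ψ : Literature.MathematicalPhysics.QuantumManyBody.BoseGas.TrialState N (Literature.MathematicalPhysics.QuantumManyBody.BoseGas.sideLength ρ N), Literature.MathematicalPhysics.QuantumManyBody.BoseGas.energy v Ψ ≤ Literature.MathematicalPhysics.QuantumManyBody.BoseGas.groundStateEnergy v N (Literature.MathematicalPhysics.QuantumManyBody.BoseGas.sideLength ρ N) + δ → ENNReal.ofReal (c * N) ≤ Literature.MathematicalPhysics.QuantumManyBody.BoseGas.occupation N ((Literature.MathematicalPhysics.QuantumManyBody.BoseGas.box (Literature.MathematicalPhysics.QuantumManyBody.BoseGas.sideLength ρ N)).indicator fun _ => ((Real.sqrt (Literature.MathematicalPhysics.QuantumManyBody.BoseGas.sideLength ρ N ^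 3))⁻¹ : ℂ)) Ψ.ψ

/-- item stmt-AtomisticToContinuum-9073 · support · rank 9 · closed · proved by Summit.AtomisticToContinuum.BoseEinsteinCondensation.Theorems.thermalGroundStateLimit_proof @ 7b950d9f5d5b (prover) · by planner
sources: ReedSimonIV1978, BratteliRobinsonII1997, LSSY2005
[support] (card P4's β → ∞ step, fixed N and L > 0) if for some c and all temperatures 0 < T ≤ T₀
there is δ(T) > 0 such that every δ-near-minimising ensemble of the free energy at T has thermal
constant-mode occupation ≥ c, then for every c′ < c and every energy slack δ′ > 0 there is a
Dirichlet trial state Ψ with energy ≤ E₀(N,L) + δ′ and ⟨φ₀,γ_Ψφ₀⟩ ≥ c′. Proof: Z(β) = Tr_sym e^{−βH}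
< ∞ (compact resolvent, Weyl), the finite-ensemble infimum of F is −T log Z (Gibbs variational
principle on the C¹ form core), Pinsker gives Tr Γ_T n(φ₀) ≥ c, Γ_T → Π₀/g in trace norm as T → 0,
so some ground state has n(φ₀) ≥ c; approximate it in form norm by C¹ Dirichlet trial states
(occupation is L²-continuous). Known analysis, heavy in Lean (no operators yet: the whole argument
must be run on quadratic forms / ensembles). [difficulty: L] -/
@[route_item "route-AtomisticToContinuum-BECThermalBridge", crux]
def ThermalGroundStateLimit : Prop :=
  ∀ v : ℝ → ENNReal, Literature.MathematicalPhysics.QuantumManyBody.BoseGas.IsRepulsiveFiniteRange v → ∀ (N : ℕ) (L T₀ c : ℝ), 0 < L → 0 < T₀ → (∀ T : ℝ, 0 < T → T ≤ T₀ → ∃ δ : ℝ, 0 < δ ∧ ∀ (m : ℕ) (p : Fin m → ℝ) (Ψ : Fin m → Literature.MathematicalPhysics.QuantumManyBody.BoseGas.TrialState N L), (∀ i, 0 ≤ p i) → ∑ i, p i = 1 → (∀ i j, i ≠ j → ∫ X, (starRingEnd ℂ) ((Ψ i).ψ X) * (Ψ j).ψ X = 0) → (∀ (m' : ℕ) (p'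 : Fin m' → ℝ) (Ψ' : Fin m' → Literature.MathematicalPhysics.QuantumManyBody.BoseGas.TrialState N L), (∀ j, 0 ≤ p' j) → ∑ j, p' j = 1 → (∀ i j, i ≠ j → ∫ X, (starRingEnd ℂ) ((Ψ' i).ψ X) * (Ψ' j).ψ X = 0) → ∑ i, ENNReal.ofReal (p i) * Literature.MathematicalPhysics.QuantumManyBody.BoseGas.energy v (Ψ i) + ENNReal.ofReal (T * ∑ j, Real.negMulLog (p' j)) ≤ ∑ j, ENNReal.ofReal (p' j) * Literature.MathematicalPhysics.QuantumManyBody.BoseGas.energy v (Ψ' j) + ENNReal.ofReal (T * ∑ i, Real.negMulLog (p i) + δ)) → ENNReal.ofReal c ≤ ∑ i, ENNReal.ofReal (p i) * Literature.MathematicalPhysics.QuantumManyBody.BoseGas.occupation N ((Literature.MathematicalPhysics.QuantumManyBody.BoseGas.box L).indicator fun _ => ((Real.sqrt (L ^ 3))⁻¹ : ℂ)) (Ψ i).ψ) → ∀ c' : ℝ, c' < c → ∀ δ' : ENNReal, 0 < δ' → ∃ Ψ : Literature.MathematicalPhysics.QuantumManyBody.BoseGas.TrialState N L, Literature.MathematicalPhysics.QuantumManyBody.BoseGas.energy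 v Ψ ≤ Literature.MathematicalPhysics.QuantumManyBody.BoseGas.groundStateEnergy v N L + δ' ∧ ENNReal.ofReal c' ≤ Literature.MathematicalPhysics.QuantumManyBody.BoseGas.occupation N ((Literature.MathematicalPhysics.QuantumManyBody.BoseGas.box L).indicator fun _ => ((Real.sqrt (L ^ 3))⁻¹ : ℂ)) Ψ.ψ

/-- item stmt-AtomisticToContinuum-9074 · support · rank 9 · closed · proved by Summit.AtomisticToContinuum.BoseEinsteinCondensation.Theorems.occupationStability_proof @ 4a4e6659c153 (prover) · by planner
sources: LSSY2005
[support] (shared verbatim with BECPalmLandscape stmt-AtomisticToContinuum-3300) for a normalised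
measurable mode u, trial states Ψ, Φ ∈ TrialState (n+1) L and |c| = 1: occ(u,Ψ)^{1/2} ≤
occ(u,Φ)^{1/2} + (n+1)^{1/2}·‖Ψ − cΦ‖₂ (Minkowski in L²(dY); occ(cΦ) = occ(Φ)). [difficulty:
provable-now] -/
@[route_item "route-AtomisticToContinuum-BECThermalBridge", crux]
def OccupationStability : Prop :=
  ∀ (n : ℕ) (L : ℝ) (u : Literature.MathematicalPhysics.QuantumManyBody.BoseGas.Space → ℂ), MeasureTheory.AEStronglyMeasurable u MeasureTheory.volume → ∫⁻ x, (‖u x‖₊ : ENNReal) ^ 2 = 1 → ∀ (Ψ Φ : Literature.MathematicalPhysics.QuantumManyBody.BoseGas.TrialState (n + 1) L) (c : ℂ), ‖c‖ = 1 → Literature.MathematicalPhysics.QuantumManyBody.BoseGas.occupation (n + 1) u Ψ.ψ ^ (1 / 2 : ℝ) ≤ Literature.MathematicalPhysics.QuantumManyBody.BoseGas.occupation (n + 1) u Φ.ψ ^ (1 / 2 : ℝ) + ((n + 1 : ℕ) : ENNReal) ^ (1 / 2 : ℝ) * (∫⁻ X, (‖Ψ.ψ X - c * Φ.ψ X‖₊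 : ENNReal) ^ 2) ^ (1 / 2 : ℝ)

/-- `OccupationStability` holds: proved by `Summit.AtomisticToContinuum.BoseEinsteinCondensation.Theorems.occupationStability_proof` @ 4a4e6659c153. -/
theorem OccupationStability_holds : OccupationStability := _root_.Summit.AtomisticToContinuum.BoseEinsteinCondensation.Theorems.occupationStability_proof

/-- item stmt-AtomisticToContinuum-13391 · assembly · rank 1 · open · by planner
sources: LSSY2005, KennedyLiebShastry1988
[assembly] ThermalBEC → ThermalMonotonicity → GroundStateRigidity → ThermalGroundStateLimit →
OccupationStability → BridgeDescent → BoseEinsteinCondensation (the audited sub-problem abbrev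
_root_.BoseEinsteinCondensation of
Summits/AtomisticToContinuum/BoseEinsteinCondensation/Statement.lean, by name; = the type of
`closes`). -/
@[route_item "route-AtomisticToContinuum-BECThermalBridge"]
def Assembly : Prop :=
  ThermalBEC → ThermalMonotonicity → GroundStateRigidity → ThermalGroundStateLimit → OccupationStability → BridgeDescent → _root_.BoseEinsteinCondensation

/-! D-0027 §2.1 — DECIDING THEOREM (planner-authored via `route open/edit --closes-file`; by planner-plancard-AtomisticToContinuum-BoseEin-82402888-g2-0 2026-08-15T19:01:29Z):
its hypotheses are this route's items and its conclusion the sub-problem Statement (glue_lint), and it elaborates with this file. -/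

/-- DECIDING THEOREM (D-0027 §2.1): the route's items imply the audited sub-problem Statement
`_root_.BoseEinsteinCondensation` — the glue support `BridgeDescent` turns the conditional positive-temperature
input `ThermalBEC`, thermal monotonicity, rigidity, the zero-temperature limit and stability into X_B1
(stmt-AtomisticToContinuum-0686), and X_B1 → BEC is the proved `AtomisticToContinuum.BECInfraredBound.bec_of_zeroMode`. -/
@[closes "route-AtomisticToContinuum-BECThermalBridge"] theorem closes : ThermalBEC → ThermalMonotonicity → GroundStateRigidity → ThermalGroundStateLimit → OccupationStability → BridgeDescent → _root_.BoseEinsteinCondensation :=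
  fun h₁ h₂ h₃ h₄ h₅ h₆ => _root_.AtomisticToContinuum.BECInfraredBound.bec_of_zeroMode (h₆ h₁ h₂ h₃ h₄ h₅)

end Summit.AtomisticToContinuum.BoseEinsteinCondensation.Theses.BECThermalBridge
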